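import Summits.CriticalPhenomena.PercolationContinuityZ3.Theorems.PercNearOneGluingNoHeavyLowerTailKnQuestion8CoefficientwiseCoreClassPeeling
import Summits.CriticalPhenomena.PercolationContinuityZ3.Theorems.PercNearOneGluingNoHeavyLowerTailKnQuestion8CoefficientwiseCoreClassKernel
import Summits.CriticalPhenomena.PercolationContinuityZ3.Theorems.PercNearOneGluingNoHeavyLowerTailKnQuestion8CoefficientwiseParallelClosure
import HarnessLib

/-!
# THEOREM CORE₂: the coefficientwise first rung CW-PA holds on the core class `N(x) = N(z) = {a, b}` for supermodular test functions

Support file (`--supports stmt-CriticalPhenomena-4575`, closed), prover `prim-cplus-coupling` (gen 29).  No definitions, no notations, no named facts,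
no sorries; standard axioms.  Memo `prim-cplus-coupling/A5-COUPLING-gen29.md` §3.4.  Parts: `…CoreClassClusters`, `…CoreClassPeeling` (identities),
`…CoreClassKernel` (the inequality on the middle graph).

Setting (prim-lf-2's CORE CLASS at `|N| = 2`, memo `prim-cplus-coupling/A5-COUPLING-gen29.md` §3.4): a finite multigraph `ends : ι → Sym2 V` whose
edge set is `E₀ = E_H ∪ {ixa, ixb, iza, izb}` with `ends ixa = s(x,a)`, `ends ixb = s(x,b)`, `ends iza = s(z,a)`, `ends izb = s(z,b)` and no edge of `E_H`
at `x` or `z`: the terminals `x, z` have the common neighbourhood `{a, b}` through single edges, the middle graph `H = (V, E_H)` is arbitrary.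
Colourings `s ⊆ E₀` (red) / `E₀ ∖ s` (blue), `K = C_x(s)`, `L = C_x(E₀ ∖ s)`, wall `T = {z ∉ K} ∩ {z ∉ L}`; `C_v(ω) = openCluster (ends '' ω) v`.
prim-lf-2's reduction (`CW-VDBHK-gen29.md` §4.4) localises the open first rung CW-PA — `0 ≤ Σ_T f(K)(g(K) − g(L))` for monotone `f, g`, the count-one
Bernstein form of van den Berg–Häggström–Kahn's conditional positive association — at root/`z`-edge contraction monotonicity plus the CORE CLASS
`N(x) = N(z)`.  This file settles the core class with `|N| = 2` for every monotone SUPERMODULAR `f` (and every monotone `g`):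
* `Coefficientwise.cwpa_coreClass_supermodular` — `0 ≤ Σ_{s ⊆ E₀ : z ∉ C_x(s), z ∉ C_x(E₀∖s)} f(C_x s)·(g(C_x s) − g(C_x(E₀∖s)))`.
Proof: `Σ_T (g(K) − g(L)) = 0` (colour swap, `sum_powerset_filter_sdiff`), so `f` may be replaced by `f − f({x})`; splitting `T` by the colours of `xa, xb`,
the doubly-blue part vanishes (`K = {x}`), the doubly-red part and the two mixed parts are rewritten by `coreClass_sum_two` / `coreClass_sum_one` (and its
`a ↔ b` mirror) as the Harris-type and the anti-GRAND sums of the core-class kernel, and `coreClass_kernel_nonneg` concludes.  Supermodularity is used exactly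
once, inside the kernel: on the wall event of `(H; a, b)` the red clusters of `a` and `b` are disjoint, so `f_H(C_a) + f_H(C_b) ≤ f_H(C_a ∪ C_b)`.
Covered: all principal filters `f = 1[S ⊆ ·]` (so the count-one coefficients of van den Berg–Kahn's Theorem 1.1 `P(s↔A, s↔B | s↮t) ≥ P(s↔A|s↮t)P(s↔B|s↮t)`
on this class), all products/minima-free supermodular weights; by the symmetry `Σ_T f(K)(g(K)−g(L)) = Σ_T g(K)(f(K)−f(L))` also every pair with ONE supermodular
partner.  Open: `f, g` both general up-set indicators (unions) — census-true (it is CW-PA; and even the kernel's lower bound survives: 10⁶ exact tests, memo §3.4).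
[cite: KozmaNitzan2024, Questions 8–9 (§5.5 p. 36) (context: the Question-8 pocket covariance programme)]
-/

namespace Summit.CriticalPhenomena.PercolationContinuityZ3.Theorems

open Finset Literature.Probability.Percolation

namespace Coefficientwise

variable {ι V : Type*}
open Classical in
/-- **CW-PA for the core class `N(x) = N(z) = {a, b}` with a supermodular test function.**  Let the multigraph `ends` have edge set
`E₀ = E_H ∪ {ixa, ixb, iza, izb}` (`ends ixa = s(x,a)`, `ixb = s(x,b)`, `iza = s(z,a)`, `izb = s(z,b)`; no edge of `E_H` at `x` or `z`; `x, z, a, b` as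
distinct as needed).  Then for every monotone supermodular `f` and monotone `g`,
`0 ≤ Σ_{s ⊆ E₀ : z ∉ C_x(s), z ∉ C_x(E₀∖s)} f(C_x s)·(g(C_x s) − g(C_x(E₀∖s)))` — the coefficientwise first rung CW-PA on prim-lf-2's core class at
`|N| = 2` for these test functions (all principal filters `f = 1[S ⊆ ·]` included). [cite: KozmaNitzan2024, Questions 8–9 (§5.5 p. 36) (context)] -/
theorem cwpa_coreClass_supermodular (ends : ι → Sym2 V) (EH E₀ : Finset ι) (x z a b : V) (ixa ixb iza izb : ι)
    (hxa : ends ixa = s(x, a)) (hxb : ends ixb = s(x, b)) (hza : ends iza = s(z, a)) (hzb : ends izb = s(z, b))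
    (hH : ∀ i ∈ EH, x ∉ ends i ∧ z ∉ ends i) (hE₀ : ∀ i, i ∈ E₀ ↔ i ∈ EH ∨ i = ixa ∨ i = ixb ∨ i = iza ∨ i = izb)
    (hnot : ixa ∉ EH ∧ ixb ∉ EH ∧ iza ∉ EH ∧ izb ∉ EH)
    (hd : ixa ≠ ixb ∧ ixa ≠ iza ∧ ixa ≠ izb ∧ ixb ≠ iza ∧ ixb ≠ izb ∧ iza ≠ izb)
    (hxz : x ≠ z) (hxa' : x ≠ a) (hxb' : x ≠ b) (hza' : z ≠ a) (hzb' : z ≠ b)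
    (f g : Set V → ℝ) (hf : Monotone f) (hfs : ∀ P Q : Set V, f P + f Q ≤ f (P ∪ Q) + f (P ∩ Q)) (hg : Monotone g) :
    0 ≤ ∑ s ∈ E₀.powerset.filter (fun s : Finset ι => z ∉ openCluster (ends '' (↑s : Set ι)) x ∧ z ∉ openCluster (ends '' (↑(E₀ \ s) : Set ι)) x),
      f (openCluster (ends '' (↑s : Set ι)) x) * (g (openCluster (ends '' (↑s : Set ι)) x) - g (openCluster (ends '' (↑(E₀ \ s) : Set ι)) x)) := by
  set K : Finset ι → Set V := fun s => openCluster (ends '' (↑s : Set ι)) x with hK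
  set Tset := E₀.powerset.filter (fun s : Finset ι => z ∉ K s ∧ z ∉ K (E₀ \ s)) with hT
  change 0 ≤ ∑ s ∈ Tset, f (K s) * (g (K s) - g (K (E₀ \ s)))
  -- normalise `f` at `{x}`
  set c : ℝ := f {x} with hc
  obtain ⟨f', hf'⟩ : ∃ f' : Set V → ℝ, f' = fun S => f S - c := ⟨_, rfl⟩
  have hswap0 : ∑ s ∈ Tset, (g (K s) - g (K (E₀ \ s))) = 0 := by
    rw [Finset.sum_sub_distrib, sub_eq_zero]
    have h := sum_powerset_filter_sdiff E₀ (fun s : Finset ι => z ∉ K s ∧ z ∉ K (E₀ \ s))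
      (fun s hs => by rw [Finset.sdiff_sdiff_eq_self hs]; exact and_comm) (fun s => g (K s))
    rw [hT]
    exact h.symm
  have hnorm : ∑ s ∈ Tset, f (K s) * (g (K s) - g (K (E₀ \ s))) = ∑ s ∈ Tset, f' (K s) * (g (K s) - g (K (E₀ \ s))) := by
    have : ∑ s ∈ Tset, f (K s) * (g (K s) - g (K (E₀ \ s))) =
        ∑ s ∈ Tset, f' (K s) * (g (K s) - g (K (E₀ \ s))) + c * ∑ s ∈ Tset, (g (K s) - g (K (E₀ \ s))) := by
      rw [Finset.mul_sum, ← Finset.sum_add_distrib]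
      refine Finset.sum_congr rfl fun s _ => ?_
      simp only [hf']; ring
    rw [this, hswap0, mul_zero, add_zero]
  rw [hnorm]
  -- split by the colours of `xa`, `xb`
  set F : Finset ι → ℝ := fun s => f' (K s) * (g (K s) - g (K (E₀ \ s))) with hF
  have hsplit : ∀ s, F s = (if ixa ∈ s ∧ ixb ∈ s then F s else 0) + (if ixa ∈ s ∧ ixb ∉ s then F s else 0)
      + (if ixb ∈ s ∧ ixa ∉ s then F s else 0) + (if ixa ∉ s ∧ ixb ∉ s then F s else 0) := by
    intro s; by_cases h1 : ixa ∈ s <;> by_cases h2 : ixb ∈ s <;> simp [h1, h2]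
  have hparts : ∑ s ∈ Tset, F s =
      (∑ s ∈ Tset.filter (fun s => ixa ∈ s ∧ ixb ∈ s), F s) + (∑ s ∈ Tset.filter (fun s => ixa ∈ s ∧ ixb ∉ s), F s)
      + (∑ s ∈ Tset.filter (fun s => ixb ∈ s ∧ ixa ∉ s), F s) + (∑ s ∈ Tset.filter (fun s => ixa ∉ s ∧ ixb ∉ s), F s) := by
    have h0 : ∑ s ∈ Tset, F s = ∑ s ∈ Tset, ((if ixa ∈ s ∧ ixb ∈ s then F s else 0) + (if ixa ∈ s ∧ ixb ∉ s then F s else 0)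
        + (if ixb ∈ s ∧ ixa ∉ s then F s else 0) + (if ixa ∉ s ∧ ixb ∉ s then F s else 0)) :=
      Finset.sum_congr rfl (fun s _ => hsplit s)
    rw [h0, Finset.sum_add_distrib, Finset.sum_add_distrib, Finset.sum_add_distrib, ← Finset.sum_filter, ← Finset.sum_filter,
      ← Finset.sum_filter, ← Finset.sum_filter]
  change 0 ≤ ∑ s ∈ Tset, F s
  rw [hparts]
  -- the four index sets as filters of `E₀.powerset`
  have hsetEq : ∀ (p : Finset ι → Prop) [DecidablePred p],
      Tset.filter p = E₀.powerset.filter (fun s : Finset ι => (z ∉ K s ∧ z ∉ K (E₀ \ s)) ∧ p s) := by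
    intro p _; ext s; simp only [hT, Finset.mem_filter, and_assoc]
  -- part RR
  have hRR : ∑ s ∈ Tset.filter (fun s => ixa ∈ s ∧ ixb ∈ s), F s =
      ∑ ω ∈ EH.powerset, f' ({x} ∪ openCluster (ends '' (↑ω : Set ι)) a ∪ openCluster (ends '' (↑ω : Set ι)) b) *
        (g ({x} ∪ openCluster (ends '' (↑ω : Set ι)) a ∪ openCluster (ends '' (↑ω : Set ι)) b) - g {x}) := by
    have h := coreClass_sum_two ends EH E₀ hxa hxb hza hzb hH hE₀ hnot hd hxz hxa' hxb' hza' hzb' (fun P Q => f' P * (g P - g Q))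
    beta_reduce at h
    rw [← h]
    exact Finset.sum_congr (hsetEq _) (fun s _ => rfl)
  -- part RB
  have hRB : ∑ s ∈ Tset.filter (fun s => ixa ∈ s ∧ ixb ∉ s), F s =
      ∑ ω ∈ EH.powerset.filter (fun ω : Finset ι => b ∉ openCluster (ends '' (↑ω : Set ι)) a ∧ b ∉ openCluster (ends '' (↑(EH \ ω) : Set ι)) a),
        f' ({x} ∪ openCluster (ends '' (↑ω : Set ι)) a) * (g ({x} ∪ openCluster (ends '' (↑ω : Set ι)) a) - g ({x} ∪ openCluster (ends '' (↑(EH \ ω) : Set ι)) b)) := by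
    have h := coreClass_sum_one ends EH E₀ hxa hxb hza hzb hH hE₀ hnot hd hxz hxa' hxb' hza' hzb' (fun P Q => f' P * (g P - g Q))
    beta_reduce at h
    rw [← h]
    exact Finset.sum_congr (hsetEq _) (fun s _ => rfl)
  -- part BR: the same lemma with `a ↔ b`
  have hBR : ∑ s ∈ Tset.filter (fun s => ixb ∈ s ∧ ixa ∉ s), F s =
      ∑ ω ∈ EH.powerset.filter (fun ω : Finset ι => b ∉ openCluster (ends '' (↑ω : Set ι)) a ∧ b ∉ openCluster (ends '' (↑(EH \ ω) : Set ι)) a),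
        f' ({x} ∪ openCluster (ends '' (↑ω : Set ι)) b) * (g ({x} ∪ openCluster (ends '' (↑ω : Set ι)) b) - g ({x} ∪ openCluster (ends '' (↑(EH \ ω) : Set ι)) a)) := by
    have hE₀' : ∀ i, i ∈ E₀ ↔ i ∈ EH ∨ i = ixb ∨ i = ixa ∨ i = izb ∨ i = iza := fun i => by rw [hE₀ i]; tauto
    have h := coreClass_sum_one ends EH E₀ (x := x) (z := z) (a := b) (b := a) hxb hxa hzb hza hH hE₀'
      ⟨hnot.2.1, hnot.1, hnot.2.2.2, hnot.2.2.1⟩ ⟨hd.1.symm, hd.2.2.2.2.1, hd.2.2.2.1, hd.2.2.1, hd.2.1, hd.2.2.2.2.2.symm⟩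
      hxz hxb' hxa' hzb' hza' (fun P Q => f' P * (g P - g Q))
    beta_reduce at h
    have hidx : EH.powerset.filter (fun ω : Finset ι => a ∉ openCluster (ends '' (↑ω : Set ι)) b ∧ a ∉ openCluster (ends '' (↑(EH \ ω) : Set ι)) b) =
        EH.powerset.filter (fun ω : Finset ι => b ∉ openCluster (ends '' (↑ω : Set ι)) a ∧ b ∉ openCluster (ends '' (↑(EH \ ω) : Set ι)) a) := by
      ext ω; simp only [Finset.mem_filter, mem_openCluster_comm ends ω b a, mem_openCluster_comm ends (EH \ ω) b a]
    rw [← hidx, ← h]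
    exact Finset.sum_congr (hsetEq _) (fun s _ => rfl)
  -- part BB vanishes
  have hBB : ∑ s ∈ Tset.filter (fun s => ixa ∉ s ∧ ixb ∉ s), F s = 0 := by
    refine Finset.sum_eq_zero fun s hs => ?_
    rw [Finset.mem_filter, hT, Finset.mem_filter, Finset.mem_powerset] at hs
    obtain ⟨⟨hsE, -⟩, h1, h2⟩ := hs
    have hKs : K s = {x} := by
      refine openCluster_eq_singleton_of_no_edge_at ends s (fun i hi => ?_)
      rcases (hE₀ i).mp (hsE hi) with h | rfl | rfl | rfl | rfl
      · exact (hH i h).1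
      · exact absurd hi h1
      · exact absurd hi h2
      · rw [hza, Sym2.mem_iff, not_or]; exact ⟨hxz, hxa'⟩
      · rw [hzb, Sym2.mem_iff, not_or]; exact ⟨hxz, hxb'⟩
    simp only [hF, hf', hKs, hc, sub_self, zero_mul]
  rw [hRR, hRB, hBR, hBB, add_zero]
  -- the kernel
  have hker := coreClass_kernel_nonneg ends EH a b (fun S => f ({x} ∪ S) - c) (fun S => g ({x} ∪ S))
    (fun P Q h => by linarith [hf (Set.union_subset_union_right {x} h)])
    (fun P Q => by
      have := hfs ({x} ∪ P) ({x} ∪ Q)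
      rw [← Set.union_union_distrib_left, ← Set.union_inter_distrib_left] at this
      linarith)
    (by simp only [Set.union_empty, hc, sub_self])
    (fun P Q h => hg (Set.union_subset_union_right {x} h))
  simp only [Set.union_empty] at hker
  rw [Finset.sum_add_distrib] at hker
  simp only [hf', Set.union_assoc]
  linarith

end Coefficientwise

end Summit.CriticalPhenomena.PercolationContinuityZ3.Theorems
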